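import Summits.ABC.IUTFork.Repair.RHReqsideWeightLawsSegment
import HarnessLib

/-!
# D-0122 AXIS B, knob k1 — THE TYPED FORM, part 3i: the SHIFTED law `a = 2` is NOT downward closed either — a tame-type integer witness with licensed
# labels `{1, …, 20, 22}`

abc-iut cell, rung LADDER-ABC:A2.RESCUE.H; seat abc-iut-reqb-typ-1 (GEN 3; D-0122 axis B typer k1/k4; R69 (A1) hardening queue); owner abc-iut-rh-lead g4
(`plan/rescue/R-H/ROUND3/REQB-SPEC.md` v0.2 §1 k1 shifted law `(j+a)² − (1+a)² + 1`, `a ∈ {1, 2}`; §3 column «seg violations»: 0 on the bed for rows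
S-k1-shift1 / S-k1-shift2, an ENGINE fact). Sequel to part 3h `Repair/RHReqsideWeightLawsSegment.lean` (this seat: closure theorem for laws with
`Δf·j ≥ 2(f(j) − 1)`; non-segment witnesses for `κ = 1`, `κ = 3/2`; shift and `κ = 5/2` left open there). Nothing re-typed.
* `shiftTwo_not_downward_closed`: at `(e, m, δ, r_in, r_out) = (71, 3, 70, 1, −3)` (`δ = e − 1`, `r_in = 1`, `r_out < 0`, `m ≥ 0` — the tame shape) the law
  `lawShift 2` (`(j+2)² − 8`) licenses label `20` (`71·⌊7/71⌋ = 0 ≤ 66`), NOT label `21` (`71·⌊71/71⌋ = 71 > 69`), and AGAIN label `22` (`71·⌊141/71⌋ = 71 ≤ 72`),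
  by `decide`: the licensed set on `{1..22}` is `{1, …, 20, 22}`. So for shift `a = 2` as for `κ = 1`, `κ = 3/2`, «seg = 1» is a property of the tabulated bed,
  not of the law (part 3h's increment condition `(2j+5)·j ≥ 2(j−1)(j+5)` indeed fails from `j = 4` on).
* RECORD (computed in-seat, no claim): no non-segment configuration was found for shift `a = 1` or for `κ = 5/2` in 3.4·10⁵ tame/wild-type integer
  configurations (`e ≤ 300`, `δ ∈ {e−1, e, e+3, 2e}`, `L = 30`) nor for shift `a = 1` in 1.7·10⁶ further ones; `κ = 5/2` meets part 3h's increment condition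
  `Δf·j ≥ 2(f(j) − 1)` numerically at every `j` tested — a proof for all `j` (ceilings) is not attempted here.
HONEST FRAMING: integer arithmetic about OUR typed cell with a free pilot law (a PARAMETER — REQB-SPEC FRAMING); the witness is a tuple of integers, not a
place of the bed; nothing here asserts that abc is proved or refuted, or that [IUTchIII] Cor. 3.12 / [IUTchIV] Thm. 1.10 holds or fails at any datum, or
takes a side on any author; typed ≠ proved; computed ≠ proved. [claim: Mochizuki2012, status: disputed] for every IUT locution.
[cite: Mochizuki2012, IUTchIV Prop. 1.2 (i)(ii) p. 10, Prop. 1.4 p. 13]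
-/

namespace Summit.ABC.IUTFork.Repair.RH.ReqsideWeightLaws

/-- **SHIFT `a = 2` IS NOT DOWNWARD CLOSED**: at `(e, m, δ, r_in, r_out) = (71, 3, 70, 1, −3)` the law `lawShift 2` licenses every label `1 … 20`, fails at
`21`, holds again at `22` (and fails at `23`). [folklore] -/
theorem shiftTwo_not_downward_closed :
    (∀ i : Fin 20, Cell (lawShift 2) 1 71 3 70 1 (-3) (i.val + 1)) ∧ ¬ Cell (lawShift 2) 1 71 3 70 1 (-3) 21 ∧
      Cell (lawShift 2) 1 71 3 70 1 (-3) 22 ∧ ¬ Cell (lawShift 2) 1 71 3 70 1 (-3) 23 := by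
  unfold Cell lawShift
  refine ⟨by decide, by decide, by decide, by decide⟩

/-- Hence at this place `T_shift2` on `{1..22}` is the demand of the single label `21` (`lawShift 2 21 − 1 = 23² − 9 = 520`) although label `22` lies above
it: `offDemand (lawShift 2) 1 71 3 70 1 (−3) 22 = 520` — no cutoff `j₀` describes the kept set (part 3a's segment-free definitions apply). [folklore] -/
theorem shiftTwo_witness_offDemand : offDemand (lawShift 2) 1 71 3 70 1 (-3) 22 = 520 := by
  obtain ⟨h20, h21, h22, -⟩ := shiftTwo_not_downward_closed
  have hcell : ∀ i, i < 22 → (Cell (lawShift 2) 1 71 3 70 1 (-3) (i + 1) ↔ i ≠ 20) := by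
    intro i hi
    rcases Nat.lt_or_ge i 20 with h | h
    · exact ⟨fun _ => by omega, fun _ => h20 ⟨i, h⟩⟩
    · interval_cases i
      · exact ⟨fun h => absurd h h21, fun h => absurd rfl h⟩
      · exact ⟨fun _ => by omega, fun _ => h22⟩
  unfold offDemand
  rw [Finset.sum_eq_single_of_mem 20 (by simp) (fun i hi hne => by
    rw [Finset.mem_range] at hi
    rw [if_pos ((hcell i hi).2 hne)])]
  rw [if_neg (fun hc => ((hcell 20 (by omega)).1 hc) rfl)]
  unfold lawShift
  norm_num

end Summit.ABC.IUTFork.Repair.RH.ReqsideWeightLaws
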